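import Mathlib
import Summits.Ventures.DiscreteObjects.Mahler.HardyContraction
import Summits.Ventures.DiscreteObjects.Mahler.SmythIsolationJets

/-!
# Smyth's theorem, isolation of `θ₀` — Parseval budgets and trinomial jets (venture `DiscreteObjects`, target L)

Cell `pub-namedobj`, seat `pub-namedobj-mahler` (gen 9). Framing: lottery ticket; floor = certified
bounds/negative ranges.

Sixth piece of the isolation part of [McKee–Smyth, *Around the Unit Circle*, Thm 12.1] (§12.2.5): the
analytic inputs of Lemmas 12.18/12.19, i.e. the "Parseval" inequalities (12.38) `Σ fᵢ² ≤ 1 + C²` and (12.47)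
`Σ gᵢ² ≤ C⁻² + (1+C)² + 1` for the series `f·(1 + aC z^k)` and `g·(C⁻¹ - a(1+C)z^k + z^{2k})`, obtained from
the `H²`-contraction `hardy_contraction`, together with the Taylor coefficients of `F · (trinomial)`:

* `jetCoeff_mul_trinomial` — jets of `F · (α₀ z^{m₀} + α₁ z^{m₁} + α₂ z^{m₂})`;
* `sum_norm_sq_coeff_trinomial` — `Σ ‖coeff‖² = ‖α₀‖² + ‖α₁‖² + ‖α₂‖²` (distinct exponents);
* `hardy_trinomial_real` — for a Schur function with real coefficients `Fₙ`:
  `Σ_{n<N} ([m₀≤n] F_{n-m₀} α₀ + [m₁≤n] F_{n-m₁} α₁ + [m₂≤n] F_{n-m₂} α₂)² ≤ α₀² + α₁² + α₂²`;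
* `hardy_budget_f`, `hardy_budget_g` — the two budgets in the exact shape used by
  `SmythIsolationCoeffBound.smyth_12_49`.
-/

namespace Summit.Ventures.DiscreteObjects.Mahler

open Polynomial Metric Finset
open scoped ComplexConjugate

noncomputable section

/-! ### Jets of `F · (trinomial)` -/

/-- `Σ_{j ≤ i} u_j · [i - j = m] α = [m ≤ i] u_{i-m} α`. -/
theorem sum_mul_ite_sub_eq (u : ℕ → ℂ) (i m : ℕ) (α : ℂ) :
    ∑ j ∈ range (i + 1), u j * (if i - j = m then α else 0) = if m ≤ i then u (i - m) * α else 0 := by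
  by_cases hm : m ≤ i
  · rw [if_pos hm, Finset.sum_eq_single_of_mem (i - m) (mem_range.mpr (by omega))]
    · rw [if_pos (by omega)]
    · intro j hj hne
      rw [mem_range] at hj
      rw [if_neg (by omega), mul_zero]
  · rw [if_neg hm]
    apply Finset.sum_eq_zero
    intro j hj
    rw [mem_range] at hj
    rw [if_neg (by omega), mul_zero]

/-- **Jets of `F · (α₀ z^{m₀} + α₁ z^{m₁} + α₂ z^{m₂})`.** -/
theorem jetCoeff_mul_trinomial {r : ℝ} (hr : 0 < r) {F : ℂ → ℂ} (hF : DifferentiableOn ℂ F (ball 0 r))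
    (α₀ α₁ α₂ : ℂ) (m₀ m₁ m₂ i : ℕ) :
    jetCoeff (fun z => F z * (C α₀ * X ^ m₀ + C α₁ * X ^ m₁ + C α₂ * X ^ m₂ : ℂ[X]).eval z) i =
      (if m₀ ≤ i then jetCoeff F (i - m₀) * α₀ else 0) + (if m₁ ≤ i then jetCoeff F (i - m₁) * α₁ else 0) +
        (if m₂ ≤ i then jetCoeff F (i - m₂) * α₂ else 0) := by
  rw [jetCoeff_mul_poly hr hF]
  simp only [coeff_add, coeff_C_mul_X_pow, mul_add, sum_add_distrib, sum_mul_ite_sub_eq]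

/-- Real form: if the jets of `f` are the reals `Fₙ` and the `αᵢ` are real, the jets of `f · (trinomial)`
are the reals `[m₀≤n] F_{n-m₀} α₀ + [m₁≤n] F_{n-m₁} α₁ + [m₂≤n] F_{n-m₂} α₂`. -/
theorem jetCoeff_mul_trinomial_real {r : ℝ} (hr : 0 < r) {f : ℂ → ℂ} (hf : DifferentiableOn ℂ f (ball 0 r))
    {F : ℕ → ℝ} (hF : ∀ n, ((F n : ℝ) : ℂ) = jetCoeff f n) (α₀ α₁ α₂ : ℝ) (m₀ m₁ m₂ n : ℕ) :
    jetCoeff (fun z => f z * (C (α₀ : ℂ) * X ^ m₀ + C (α₁ : ℂ) * X ^ m₁ + C (α₂ : ℂ) * X ^ m₂ : ℂ[X]).eval z) n =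
      (((if m₀ ≤ n then F (n - m₀) * α₀ else 0) + (if m₁ ≤ n then F (n - m₁) * α₁ else 0) +
        (if m₂ ≤ n then F (n - m₂) * α₂ else 0) : ℝ) : ℂ) := by
  rw [jetCoeff_mul_trinomial hr hf, ← hF (n - m₀), ← hF (n - m₁), ← hF (n - m₂)]
  push_cast
  split_ifs <;> simp

/-! ### The Parseval budget of a trinomial -/

/-- Coefficientwise `‖·‖²` of a trinomial with distinct exponents. -/
theorem norm_sq_coeff_trinomial (α₀ α₁ α₂ : ℂ) {m₀ m₁ m₂ : ℕ} (h01 : m₀ ≠ m₁) (h02 : m₀ ≠ m₂)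
    (h12 : m₁ ≠ m₂) (n : ℕ) :
    ‖(C α₀ * X ^ m₀ + C α₁ * X ^ m₁ + C α₂ * X ^ m₂ : ℂ[X]).coeff n‖ ^ 2 =
      (if n = m₀ then ‖α₀‖ ^ 2 else 0) + (if n = m₁ then ‖α₁‖ ^ 2 else 0) +
        (if n = m₂ then ‖α₂‖ ^ 2 else 0) := by
  simp only [coeff_add, coeff_C_mul_X_pow]
  by_cases h0 : n = m₀
  · subst h0
    simp [h01, h02]
  · by_cases h1 : n = m₁
    · subst h1
      simp [h0, h12]
    · by_cases h2 : n = m₂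
      · subst h2
        simp [h0, h1]
      · simp [h0, h1, h2]

/-- **`Σₙ ‖pₙ‖² = ‖α₀‖² + ‖α₁‖² + ‖α₂‖²`** for `p = α₀ X^{m₀} + α₁ X^{m₁} + α₂ X^{m₂}` with distinct exponents
(sum over `n ≤ natDegree p`, the range used by `hardy_contraction`). -/
theorem sum_norm_sq_coeff_trinomial (α₀ α₁ α₂ : ℂ) {m₀ m₁ m₂ : ℕ} (h01 : m₀ ≠ m₁) (h02 : m₀ ≠ m₂)
    (h12 : m₁ ≠ m₂) :
    ∑ n ∈ range ((C α₀ * X ^ m₀ + C α₁ * X ^ m₁ + C α₂ * X ^ m₂ : ℂ[X]).natDegree + 1),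
      ‖(C α₀ * X ^ m₀ + C α₁ * X ^ m₁ + C α₂ * X ^ m₂ : ℂ[X]).coeff n‖ ^ 2 =
      ‖α₀‖ ^ 2 + ‖α₁‖ ^ 2 + ‖α₂‖ ^ 2 := by
  set p : ℂ[X] := C α₀ * X ^ m₀ + C α₁ * X ^ m₁ + C α₂ * X ^ m₂ with hp
  set D := m₀ + m₁ + m₂ + 1 with hD
  set M := p.natDegree + 1 + D with hM
  have h1 : ∑ n ∈ range (p.natDegree + 1), ‖p.coeff n‖ ^ 2 = ∑ n ∈ range M, ‖p.coeff n‖ ^ 2 := by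
    apply Finset.sum_subset (range_subset_range.mpr (by omega))
    intro n hn hn'
    rw [mem_range] at hn hn'
    rw [coeff_eq_zero_of_natDegree_lt (by omega), norm_zero]
    norm_num
  have h2 : ∑ n ∈ range D, ‖p.coeff n‖ ^ 2 = ∑ n ∈ range M, ‖p.coeff n‖ ^ 2 := by
    apply Finset.sum_subset (range_subset_range.mpr (by omega))
    intro n hn hn'
    rw [mem_range] at hn hn'
    rw [hp, norm_sq_coeff_trinomial α₀ α₁ α₂ h01 h02 h12, if_neg (by omega), if_neg (by omega),
      if_neg (by omega)]
    norm_num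
  rw [h1, ← h2, Finset.sum_congr rfl (fun n _ => by rw [hp, norm_sq_coeff_trinomial α₀ α₁ α₂ h01 h02 h12 n]),
    sum_add_distrib, sum_add_distrib, sum_ite_eq', sum_ite_eq', sum_ite_eq',
    if_pos (mem_range.mpr (by omega)), if_pos (mem_range.mpr (by omega)), if_pos (mem_range.mpr (by omega))]

/-! ### The budgets -/

/-- **Parseval budget of `f · (real trinomial)`** for a Schur function `f` with real coefficients `Fₙ`:
`Σ_{n<N} ([m₀≤n] F_{n-m₀} α₀ + [m₁≤n] F_{n-m₁} α₁ + [m₂≤n] F_{n-m₂} α₂)² ≤ α₀² + α₁² + α₂²`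
([McKee–Smyth (12.38), (12.47)], as inequalities, from `hardy_contraction`). -/
theorem hardy_trinomial_real {f : ℂ → ℂ} (hf : IsSchur f) {F : ℕ → ℝ}
    (hF : ∀ n, ((F n : ℝ) : ℂ) = jetCoeff f n) (α₀ α₁ α₂ : ℝ) {m₀ m₁ m₂ : ℕ} (h01 : m₀ ≠ m₁)
    (h02 : m₀ ≠ m₂) (h12 : m₁ ≠ m₂) (N : ℕ) :
    ∑ n ∈ range N, ((if m₀ ≤ n then F (n - m₀) * α₀ else 0) + (if m₁ ≤ n then F (n - m₁) * α₁ else 0) +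
      (if m₂ ≤ n then F (n - m₂) * α₂ else 0)) ^ 2 ≤ α₀ ^ 2 + α₁ ^ 2 + α₂ ^ 2 := by
  set p : ℂ[X] := C (α₀ : ℂ) * X ^ m₀ + C (α₁ : ℂ) * X ^ m₁ + C (α₂ : ℂ) * X ^ m₂ with hp
  have hH := hardy_contraction hf p N
  rw [hp, sum_norm_sq_coeff_trinomial _ _ _ h01 h02 h12, Complex.norm_real, Complex.norm_real,
    Complex.norm_real, Real.norm_eq_abs, Real.norm_eq_abs, Real.norm_eq_abs, sq_abs, sq_abs, sq_abs] at hH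
  refine le_trans (le_of_eq ?_) hH
  refine sum_congr rfl fun n _ => ?_
  have e : (fun z => (C (α₀ : ℂ) * X ^ m₀ + C (α₁ : ℂ) * X ^ m₁ + C (α₂ : ℂ) * X ^ m₂ : ℂ[X]).eval z * f z) =
      fun z => f z * (C (α₀ : ℂ) * X ^ m₀ + C (α₁ : ℂ) * X ^ m₁ + C (α₂ : ℂ) * X ^ m₂ : ℂ[X]).eval z :=
    funext fun z => mul_comm _ _
  rw [e, jetCoeff_mul_trinomial_real one_pos hf.differentiableOn hF, Complex.norm_real, Real.norm_eq_abs,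
    sq_abs]

/-- **(12.38) as used.**  `Σ_{n<N} (Fₙ + [k≤n] a C₀ F_{n-k})² ≤ 1 + C₀²` for `a² = 1`. -/
theorem hardy_budget_f {f : ℂ → ℂ} (hf : IsSchur f) {F : ℕ → ℝ} (hF : ∀ n, ((F n : ℝ) : ℂ) = jetCoeff f n)
    {a C₀ : ℝ} (haa : a * a = 1) {k : ℕ} (hk : 1 ≤ k) (N : ℕ) :
    ∑ n ∈ range N, (F n + if k ≤ n then a * C₀ * F (n - k) else 0) ^ 2 ≤ 1 + C₀ ^ 2 := by
  have h := hardy_trinomial_real hf hF 1 (a * C₀) 0 (m₀ := 0) (m₁ := k) (m₂ := 2 * k)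
    (by omega) (by omega) (by omega) N
  have e : ∀ n : ℕ, ((if 0 ≤ n then F (n - 0) * 1 else 0) + (if k ≤ n then F (n - k) * (a * C₀) else 0) +
      (if 2 * k ≤ n then F (n - 2 * k) * 0 else 0)) = F n + if k ≤ n then a * C₀ * F (n - k) else 0 := by
    intro n
    rw [if_pos (Nat.zero_le n), Nat.sub_zero]
    split_ifs <;> ring
  simp only [e] at h
  have ha2 : (a * C₀) ^ 2 = C₀ ^ 2 := by rw [mul_pow, show a ^ 2 = 1 by rw [sq]; exact haa, one_mul]
  linarith

/-- **(12.47) as used.**  `Σ_{n<N} (Ci Gₙ - [k≤n] a(1+C₀) G_{n-k} + [2k≤n] G_{n-2k})² ≤ Ci² + (1+C₀)² + 1`. -/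
theorem hardy_budget_g {g : ℂ → ℂ} (hg : IsSchur g) {G : ℕ → ℝ} (hG : ∀ n, ((G n : ℝ) : ℂ) = jetCoeff g n)
    {a C₀ Ci : ℝ} (haa : a * a = 1) {k : ℕ} (hk : 1 ≤ k) (N : ℕ) :
    ∑ n ∈ range N, (Ci * G n - (if k ≤ n then a * (1 + C₀) * G (n - k) else 0) +
      (if 2 * k ≤ n then G (n - 2 * k) else 0)) ^ 2 ≤ Ci ^ 2 + (1 + C₀) ^ 2 + 1 := by
  have h := hardy_trinomial_real hg hG Ci (-(a * (1 + C₀))) 1 (m₀ := 0) (m₁ := k) (m₂ := 2 * k)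
    (by omega) (by omega) (by omega) N
  have e : ∀ n : ℕ, ((if 0 ≤ n then G (n - 0) * Ci else 0) + (if k ≤ n then G (n - k) * (-(a * (1 + C₀))) else 0) +
      (if 2 * k ≤ n then G (n - 2 * k) * 1 else 0)) =
      Ci * G n - (if k ≤ n then a * (1 + C₀) * G (n - k) else 0) + (if 2 * k ≤ n then G (n - 2 * k) else 0) := by
    intro n
    rw [if_pos (Nat.zero_le n), Nat.sub_zero]
    split_ifs <;> ring
  simp only [e] at h
  have ha2 : (-(a * (1 + C₀))) ^ 2 = (1 + C₀) ^ 2 := by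
    rw [neg_pow_two, mul_pow, show a ^ 2 = 1 by rw [sq]; exact haa, one_mul]
  linarith

end

end Summit.Ventures.DiscreteObjects.Mahler
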